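import Mathlib
import Summits.Ventures.LatticeQCDFlow.Scoring.LagProductCovariance
import HarnessLib

/-!
# Every positive-semidefinite covariance is realised by the linear statistics of a standard Gaussian vector: the Wick family of any finite Gaussian window exists

HONEST FRAMING: exact (Metropolis-corrected) sampling algorithms for lattice gauge theory;
figures of merit are autocorrelation/cost numbers at stated couplings and volumes; no
continuum-physics claim.

Venture `LatticeQCDFlow` (cell pub-lqcd), sub-topic `Scoring`; FANOUT row 16 (`su2-base`), GEN-6.
NEW WORK of the cell over Mathlib (the continuous functional calculus square root `CFC.sqrt` of a
positive-semidefinite matrix, `open scoped MatrixOrder`) and this packet's `LagProductCovariance`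
(`gaussLin`, `gramCov`, `isWickFamily_gaussLin`).  Nothing is cited as a fact.

Twelfth file of the ERROR-OF-THE-ERROR packet.  `LagProductCovariance` typed 'every centred
Gaussian vector is of this form (rows of a square root of its covariance) — said, not typed'.  It is
typed here:

* `exists_symm_mul_self_eq` — a real positive-semidefinite matrix `S` has a symmetric square root
  `B = Bᵀ`, `B B = S` (`CFC.sqrt`);
* **`exists_gramCov_eq`** — hence coefficient rows `a : ℕ → Fin n → ℝ` (zero beyond `n`) with
  `gramCov a i k = S i k` for all `i, k < n`;
* **`exists_isWickFamily_of_posSemidef`** — for every positive-semidefinite `S : Matrix (Fin n)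
  (Fin n) ℝ` there is a Wick family — the linear statistics `gaussLin b a` of the standard Gaussian
  vector of `EuclideanSpace ℝ (Fin n)` in its standard orthonormal basis — whose covariance is `S` on
  the window `{0,…,n−1}`: the Gaussian model of ANY finite stretch of a stationary series (Toeplitz
  `S i k = c(k−i)`, `isWickFamily_window_of_toeplitz`) is an instance of the packet's hypothesis.

NOT CLAIMED: an infinite stationary Gaussian process on all of `ℕ` with a prescribed summable
covariance (Kolmogorov extension / spectral construction — the packet's `N → ∞` theorems quantify
over Wick families indexed by `ℕ`; this file realises every finite window, not the projective
limit).
-/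

noncomputable section

open MeasureTheory ProbabilityTheory Finset Matrix
open scoped MatrixOrder

namespace Summit.Ventures.LatticeQCDFlow.Scoring

/-- A real positive-semidefinite matrix has a symmetric square root: `Bᵀ = B`, `B B = S`. -/
theorem exists_symm_mul_self_eq {n : Type*} [Fintype n] [DecidableEq n] (S : Matrix n n ℝ)
    (hS : S.PosSemidef) : ∃ B : Matrix n n ℝ, B.transpose = B ∧ B * B = S := by
  refine ⟨CFC.sqrt S, ?_, ?_⟩
  · have h := (CFC.sqrt_nonneg S).isSelfAdjoint
    rw [IsSelfAdjoint, Matrix.star_eq_conjTranspose, Matrix.conjTranspose_eq_transpose_of_trivial] at h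
    exact h
  · have := CFC.sq_sqrt S hS.nonneg
    simpa [sq] using this

/-- Rows of a matrix on `Fin n`, extended by zero to all of `ℕ`. [ours] -/
def rowsExt {n : ℕ} (B : Matrix (Fin n) (Fin n) ℝ) (i : ℕ) (p : Fin n) : ℝ :=
  if h : i < n then B ⟨i, h⟩ p else 0

/-- On the window, `rowsExt B i = B i`. -/
theorem rowsExt_apply_fin {n : ℕ} (B : Matrix (Fin n) (Fin n) ℝ) (i p : Fin n) :
    rowsExt B i p = B i p := by
  simp [rowsExt, i.isLt]

/-- **Every positive-semidefinite `S` is a Gram covariance**: `gramCov (rowsExt B) i k = S i k` on the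
window, `B` the symmetric square root. -/
theorem exists_gramCov_eq {n : ℕ} (S : Matrix (Fin n) (Fin n) ℝ) (hS : S.PosSemidef) :
    ∃ a : ℕ → Fin n → ℝ, ∀ i k : Fin n, gramCov a i k = S i k := by
  obtain ⟨B, hBt, hBB⟩ := exists_symm_mul_self_eq S hS
  refine ⟨rowsExt B, fun i k => ?_⟩
  rw [gramCov]
  simp_rw [rowsExt_apply_fin]
  rw [← hBB, Matrix.mul_apply]
  refine sum_congr rfl fun p _ => ?_
  rw [show B k p = B p k from by rw [← Matrix.transpose_apply B k p, hBt]]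

/-- **The Wick family of any finite Gaussian window exists.**  For every positive-semidefinite
`S : Matrix (Fin n) (Fin n) ℝ` there are coefficient rows `a` such that the linear statistics
`gaussLin b a` of the standard Gaussian vector of `ℝⁿ` (standard orthonormal basis `b`) form a Wick
family whose covariance is `S` on `{0,…,n−1}`. -/
theorem exists_isWickFamily_of_posSemidef {n : ℕ} (S : Matrix (Fin n) (Fin n) ℝ) (hS : S.PosSemidef) :
    ∃ a : ℕ → Fin n → ℝ,
      IsWickFamily (gaussLin (EuclideanSpace.basisFun (Fin n) ℝ) a) (gramCov a)
          (stdGaussian (EuclideanSpace ℝ (Fin n)))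
        ∧ ∀ i k : Fin n, gramCov a i k = S i k := by
  obtain ⟨a, ha⟩ := exists_gramCov_eq S hS
  exact ⟨a, isWickFamily_gaussLin _ a, ha⟩

/-- The Toeplitz (stationary) case: if the window covariance `S i k = c(k − i)` is positive
semidefinite, the Gaussian window is a Wick family with `C i k = c(k − i)` for `i, k < n`. -/
theorem isWickFamily_window_of_toeplitz {n : ℕ} (c : ℤ → ℝ)
    (hS : (Matrix.of fun i k : Fin n => c ((k : ℤ) - i)).PosSemidef) :
    ∃ a : ℕ → Fin n → ℝ,
      IsWickFamily (gaussLin (EuclideanSpace.basisFun (Fin n) ℝ) a) (gramCov a)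
          (stdGaussian (EuclideanSpace ℝ (Fin n)))
        ∧ ∀ i k : Fin n, gramCov a i k = c ((k : ℤ) - i) := by
  obtain ⟨a, hW, ha⟩ := exists_isWickFamily_of_posSemidef _ hS
  exact ⟨a, hW, fun i k => by rw [ha]; rfl⟩

end Summit.Ventures.LatticeQCDFlow.Scoring
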